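import Literature.RepresentationTheory.FiniteGroups.InducedRecognition
import Literature.NumberTheory.GaloisRepresentations.DihedralTypeMonomial
import Literature.NumberTheory.GaloisRepresentations.ArtinFormalism
import HarnessLib

/-!
# Dihedral-type Artin representations are induced from a quadratic extension
(trunk GalRep; companion to `DihedralTypeMonomial`, `ArtinFormalism`, `ArtinRestriction`)

Let `K` be a number field and `ρ : Γ_K → GL_2(ℂ)` a (framed) Artin representation of
**dihedral type** (`Literature.NumberTheory.GaloisRepresentations.IsDihedralType`: projective image `≅ D_m`, `m ≥ 2`).  This file proves
the Galois-theoretic form of "dihedral = monomial = induced from a quadratic extension"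
(Gelbart, *Three lectures …* (1997), §4.3, Proposition (ii): "Dihedral type: `σ` is
irreducible of the form `Ind_{W_E}^{W_F} θ`, with `θ` a character …, `E` a quadratic extension
of `F`, and `θ ≠ θ^τ`"; Tunnell, Bull. AMS 5 (1981), p. 173: these are Artin's "monomial
representations", for which "Artin proved the conjecture"):

* `Literature.NumberTheory.GaloisRepresentations.FramedArtinRep.exists_isInducedFrom_of_isDihedralType` (**proved**): there are a
  quadratic subextension `M = K̄^H ⊆ K̄` of `K` (an `IntermediateField`, finite of degree `2`
  over `K`) and a **non-trivial** character `ψ : Γ_M → GL_1(ℂ)` (a rank-one framed Artin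
  representation of `M`) such that `ρ ≅ Ind_{Γ_M}^{Γ_K} ψ` in the sense of
  `Literature.NumberTheory.GaloisRepresentations.ArtinRep.IsInducedFrom` (Mathlib `Representation.ind` along
  `absGaloisRestrict K M : Γ_M → Γ_K`).

Proof.  `DihedralTypeMonomial` gives the index-two subgroup `H ≤ Γ_K` and a basis in which
`ρ|_H` is diagonal and `ρ(Γ_K ∖ H)` antidiagonal; `H ⊇ ker ρ` is open, so `M = K̄^H` is a
quadratic extension with `res(Γ_M) = H` (`ArtinRestriction`:
`exists_mem_range_absGaloisRestrict_fixedField_iff`, `H ◁ Γ_K`); `ψ` is the first diagonal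
entry composed with the restriction map (continuous, multiplicative on `H`); the eigenline
`ℂ v₀` of `ψ` and its translate by any `c ∉ H` span `ℂ²`, and `2 = [Γ_K : H] · 1`, so the
recognition theorem `Literature.RepresentationTheory.FiniteGroups.nonempty_equiv_ind` (Serre §3.3) applies.  Non-triviality:
conjugating by `c ∉ H` swaps the two diagonal entries, and some `h₀ ∈ H` has distinct ones.

## Mathlib / tree search

No induced-representation recognition for Galois representations exists in Mathlib or the tree
besides `ArtinRep.IsInducedFrom` (definition) and the named fact
`exists_framedArtinRep_isInducedFrom` (`ArtinFormalism`, existence of *some* framed model of an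
induced representation — not used here).  `lean search exists_isInducedFrom`: nothing.  No
definition is introduced.

## References

* S. Gelbart, *Three lectures on the modularity of `ρ̄_{E,3}` and the Langlands reciprocity
  conjecture*, in *Modular Forms and Fermat's Last Theorem*, Springer 1997, §4.3, Proposition
  (ii). [Gelbart1997]
* J. Tunnell, *Artin's conjecture for representations of octahedral type*, Bull. AMS 5 (1981),
  p. 173. [Tunnell1981]
* J.-P. Serre, *Linear Representations of Finite Groups*, GTM 42 (1977), §3.3, §7.1.
  [SerreLinearRepresentations1977]
-/

noncomputable section

open Matrix Subgroup Field
open scoped MatrixGroups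

namespace Literature.NumberTheory.GaloisRepresentations

namespace FramedArtinRep

universe u

variable {K : Type u} [Field K] [NumberField K]

/-- For a diagonal `2 × 2` matrix `D`, `D e₀ = D₀₀ e₀`. [folklore] -/
theorem mulVec_single_of_isDg {D : Matrix (Fin 2) (Fin 2) ℂ} (hD : GL2.IsDg D) :
    D *ᵥ Pi.single 0 1 = D 0 0 • (Pi.single 0 1 : Fin 2 → ℂ) := by
  ext i
  fin_cases i
  · simp [Matrix.mulVec, dotProduct, Fin.sum_univ_two]
  · simp [Matrix.mulVec, dotProduct, Fin.sum_univ_two, hD.2]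

/-- For an antidiagonal `2 × 2` matrix `Y`, `Y e₀ = Y₁₀ e₁`. [folklore] -/
theorem mulVec_single_of_isAd {Y : Matrix (Fin 2) (Fin 2) ℂ} (hY : GL2.IsAd Y) :
    Y *ᵥ Pi.single 0 1 = Y 1 0 • (Pi.single 1 1 : Fin 2 → ℂ) := by
  ext i
  fin_cases i
  · simp [Matrix.mulVec, dotProduct, Fin.sum_univ_two, hY.1]
  · simp [Matrix.mulVec, dotProduct, Fin.sum_univ_two]

/-- The `(0,0)` entry is multiplicative on diagonal `2 × 2` matrices. [folklore] -/
theorem mul_apply_zero_zero_of_isDg {x y : Matrix (Fin 2) (Fin 2) ℂ} (hx : GL2.IsDg x) :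
    (x * y) 0 0 = x 0 0 * y 0 0 := by
  simp [Matrix.mul_apply, Fin.sum_univ_two, hx.1]

/-- Conjugating a diagonal matrix by an antidiagonal one swaps the diagonal entries:
`(Y D Y⁻¹)₀₀ = D₁₁`. [folklore] -/
theorem conj_apply_zero_zero_of_isAd_of_isDg {Y D : Matrix (Fin 2) (Fin 2) ℂ} (hY : GL2.IsAd Y)
    (hYdet : Y.det ≠ 0) (hD : GL2.IsDg D) : (Y * D * Y⁻¹) 0 0 = D 1 1 := by
  rw [hD.eq_diagonal, Matrix.mul_assoc]
  have h := GL2.IsAd.mul_diagonal (GL2.IsAd.inv hY) ![D 0 0, D 1 1]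
  -- `Y⁻¹ * diag(d) = diag(d₁, d₀) * Y⁻¹`, so `Y * (diag d * Y⁻¹)` … use `Y * Y⁻¹ = 1`
  have hYY : Y * Y⁻¹ = 1 := Matrix.mul_nonsing_inv Y (isUnit_iff_ne_zero.mpr hYdet)
  have : diagonal ![D 0 0, D 1 1] * Y⁻¹ = Y⁻¹ * diagonal ![D 1 1, D 0 0] := by
    have h' := GL2.IsAd.mul_diagonal (GL2.IsAd.inv hY) ![D 1 1, D 0 0]
    simpa using h'.symm
  rw [this, ← Matrix.mul_assoc, hYY, Matrix.one_mul, diagonal_apply_eq]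
  rfl

/-- **Dihedral-type Artin representations are induced from a quadratic extension**
(Gelbart 1997, §4.3, Proposition (ii); Tunnell 1981, p. 173, "monomial representations").
Let `ρ : Γ_K → GL_2(ℂ)` be a framed Artin representation with finite image of dihedral type.
Then there are an intermediate field `K ⊆ M ⊆ K̄`, finite of degree `2` over `K`, and a
rank-one framed Artin representation `ψ : Γ_M → GL_1(ℂ)` of `M`, non-trivial, such that
`ρ ≅ Ind_{Γ_M}^{Γ_K} ψ` (`ArtinRep.IsInducedFrom`, along `absGaloisRestrict K M`).
[cite: Gelbart1997, §4.3, Proposition (ii)] [cite: Tunnell1981, p. 173] -/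
theorem exists_isInducedFrom_of_isDihedralType (ρ : FramedArtinRep K 2)
    [Finite ρ.toMonoidHom.range] (hρ : IsDihedralType ρ.toMonoidHom) :
    ∃ M : IntermediateField K (AlgebraicClosure K), FiniteDimensional K M ∧
      Module.finrank K M = 2 ∧
      ∃ ψ : FramedArtinRep M 1, (∃ γ, ψ γ ≠ 1) ∧ ρ.toArtinRep.IsInducedFrom ψ.toArtinRep := by
  classical
  obtain ⟨H, P, hHi, hDg, hAd, h₀, hh₀H, hh₀⟩ := exists_monomial_of_isDihedralType ρ.toMonoidHom hρ
  haveI hHn : H.Normal := normal_of_index_eq_two hHi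
  -- notation: `D g = P ρ(g) P⁻¹`
  set D : absoluteGaloisGroup K → Matrix (Fin 2) (Fin 2) ℂ := fun g =>
    ((conjGL P ρ.toMonoidHom g : GL (Fin 2) ℂ) : Matrix (Fin 2) (Fin 2) ℂ) with hDdef
  have hDmul : ∀ g g', D (g * g') = D g * D g' := fun g g' => by
    simp only [hDdef, map_mul, Matrix.GeneralLinearGroup.coe_mul]
  have hDone : D 1 = 1 := by simp only [hDdef, map_one, Matrix.GeneralLinearGroup.coe_one]
  have hDdet : ∀ g, (D g).det ≠ 0 := fun g => GL2.det_ne_zero _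
  -- `H` is open: it contains `ker ρ`
  have hker : IsOpen (ρ.toMonoidHom.ker : Set (absoluteGaloisGroup K)) :=
    isOpen_ker_of_finite_range ρ
  have hkerle : ρ.toMonoidHom.ker ≤ H := by
    intro g hg
    by_contra hgH
    have h1 : D g = 1 := by
      rw [MonoidHom.mem_ker] at hg
      simp only [hDdef, conjGL_apply, hg, mul_one, mul_inv_cancel,
        Matrix.GeneralLinearGroup.coe_one]
    have h2 := (hAd g hgH).1
    rw [show ((conjGL P ρ.toMonoidHom g : GL (Fin 2) ℂ) : Matrix (Fin 2) (Fin 2) ℂ) = D g from rfl,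
      h1] at h2
    exact one_ne_zero h2
  have hHopen : IsOpen (H : Set (absoluteGaloisGroup K)) := Subgroup.isOpen_mono hkerle hker
  -- the quadratic field `M = K̄^H`
  set M : IntermediateField K (AlgebraicClosure K) := IntermediateField.fixedField H with hM
  haveI hMfin : FiniteDimensional K M := finiteDimensional_fixedField_of_isOpen H hHopen
  have hMdeg : Module.finrank K M = 2 := by rw [hM, finrank_fixedField_of_isOpen H hHopen, hHi]
  -- the restriction map `r : Γ_M → Γ_K` has image `H`
  set r := absGaloisRestrict K M with hr
  obtain ⟨g₁, hg₁⟩ := exists_mem_range_absGaloisRestrict_fixedField_iff H hHopen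
  have hrange : ∀ γ : absoluteGaloisGroup K, γ ∈ r.toMonoidHom.range ↔ γ ∈ H := by
    intro γ
    have h1 : γ ∈ H ↔ g₁⁻¹ * γ * g₁ ∈ H := by
      constructor
      · intro h; exact hHn.conj_mem' γ h g₁
      · intro h
        have := hHn.conj_mem _ h g₁
        simpa [mul_assoc] using this
    rw [h1, ← hg₁ γ]
  have hrH : ∀ δ : absoluteGaloisGroup M, r δ ∈ H := fun δ => (hrange _).mp ⟨δ, rfl⟩
  have hrangeEq : r.toMonoidHom.range = H := Subgroup.ext hrange
  -- the character `χ = D(r ·)₀₀ : Γ_M → ℂˣ`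
  have hχne : ∀ δ : absoluteGaloisGroup M, D (r δ) 0 0 ≠ 0 := fun δ =>
    ((hDg _ (hrH δ)).entry_ne_zero (hDdet _)).1
  let χ₀ : absoluteGaloisGroup M →* ℂˣ :=
    { toFun := fun δ => Units.mk0 (D (r δ) 0 0) (hχne δ)
      map_one' := by
        ext
        simp only [Units.val_mk0, map_one, hDone, Matrix.one_apply_eq, Units.val_one]
      map_mul' := fun δ δ' => by
        ext
        simp only [Units.val_mk0, Units.val_mul, map_mul, hDmul]
        exact mul_apply_zero_zero_of_isDg (hDg _ (hrH δ)) }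
  have hχ₀ : ∀ δ, (χ₀ δ : ℂ) = D (r δ) 0 0 := fun δ => rfl
  have hχ₀cont : Continuous χ₀ := by
    have hval : Continuous fun δ : absoluteGaloisGroup M => (χ₀ δ : ℂ) := by
      simp only [hχ₀, hDdef, conjGL_apply, Matrix.GeneralLinearGroup.coe_mul]
      refine Continuous.matrix_elem ?_ 0 0
      refine (continuous_const.matrix_mul ?_).matrix_mul continuous_const
      exact Units.continuous_val.comp (ρ.continuous_toFun.comp r.continuous_toFun)
    refine Units.continuous_iff.mpr ⟨hval, ?_⟩
    have : (fun δ : absoluteGaloisGroup M => ((χ₀ δ)⁻¹ : ℂˣ).val) =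
        (fun δ : absoluteGaloisGroup M => (χ₀ δ : ℂ)) ∘ fun δ => δ⁻¹ := by
      funext δ; simp only [Function.comp_apply, map_inv]
    rw [this]
    exact hval.comp continuous_inv
  let χ : absoluteGaloisGroup M →ₜ* ℂˣ := ⟨χ₀, hχ₀cont⟩
  have hχ : ∀ δ, ((χ δ : ℂˣ) : ℂ) = D (r δ) 0 0 := fun δ => rfl
  let ψ : FramedArtinRep M 1 :=
    ContinuousMonoidHom.comp
      (FramedRep.unitsContinuousMulEquivOfUnique (Fin 1) ℂ : ℂˣ →ₜ* GL (Fin 1) ℂ) χ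
  have hψ : ∀ δ (i j : Fin 1),
      ((ψ δ : GL (Fin 1) ℂ) : Matrix (Fin 1) (Fin 1) ℂ) i j = D (r δ) 0 0 := fun δ i j => rfl
  refine ⟨M, hMfin, hMdeg, ψ, ?_, ?_⟩
  · -- non-triviality: some `h ∈ H` has `D(h)₀₀ ≠ 1`
    have hHtop : H ≠ ⊤ := by
      intro h; rw [h, Subgroup.index_top] at hHi; exact absurd hHi (by norm_num)
    obtain ⟨c, hc⟩ : ∃ c, c ∉ H := by
      by_contra! hall; exact hHtop (eq_top_iff.mpr fun g _ => hall g)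
    have hconj : (D (c * h₀ * c⁻¹)) 0 0 = D h₀ 1 1 := by
      rw [hDmul, hDmul, show D c⁻¹ = (D c)⁻¹ from by
        simp only [hDdef, map_inv, Matrix.coe_units_inv]]
      exact conj_apply_zero_zero_of_isAd_of_isDg (hAd c hc) (hDdet c) (hDg h₀ hh₀H)
    -- one of `h₀`, `c h₀ c⁻¹` has `(0,0)` entry `≠ 1`
    obtain ⟨h, hhH, hh1⟩ : ∃ h, h ∈ H ∧ D h 0 0 ≠ 1 := by
      by_cases h00 : D h₀ 0 0 = 1
      · refine ⟨c * h₀ * c⁻¹, hHn.conj_mem h₀ hh₀H c, ?_⟩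
        rw [hconj]
        intro h11
        exact hh₀ (h00.trans h11.symm)
      · exact ⟨h₀, hh₀H, h00⟩
    obtain ⟨δ, hδ⟩ : h ∈ r.toMonoidHom.range := (hrange h).mpr hhH
    refine ⟨δ, fun hψ1 => hh1 ?_⟩
    have := congrArg (fun x : GL (Fin 1) ℂ => (x : Matrix (Fin 1) (Fin 1) ℂ) 0 0) hψ1
    simp only [hψ, Matrix.GeneralLinearGroup.coe_one, Matrix.one_apply_eq] at this
    rw [← this]
    exact congrArg (fun g => D g 0 0) hδ.symm
  · -- the induced structure, via the recognition theorem
    let σ := ρ.toArtinRep.toRepresentation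
    let π := ψ.toArtinRep.toRepresentation
    have hσ : ∀ g v, σ g v = ((ρ g : GL (Fin 2) ℂ) : Matrix (Fin 2) (Fin 2) ℂ) *ᵥ v :=
      fun g v => rfl
    have hπ : ∀ δ (w : Fin 1 → ℂ), π δ w = D (r δ) 0 0 • w := by
      intro δ w
      change ((ψ δ : GL (Fin 1) ℂ) : Matrix (Fin 1) (Fin 1) ℂ) *ᵥ w = _
      ext i
      simp only [Matrix.mulVec, dotProduct, Finset.univ_unique, Fin.default_eq_zero,
        Finset.sum_singleton, hψ, Pi.smul_apply, smul_eq_mul, Fin.isValue]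
      rw [Subsingleton.elim i 0]
    -- eigenvectors `u₀ = P⁻¹ e₀`, `u₁ = P⁻¹ e₁`
    set Pi' : Matrix (Fin 2) (Fin 2) ℂ := ((P⁻¹ : GL (Fin 2) ℂ) : Matrix (Fin 2) (Fin 2) ℂ)
      with hPi'
    set u₀ : Fin 2 → ℂ := Pi' *ᵥ Pi.single 0 1 with hu₀
    set u₁ : Fin 2 → ℂ := Pi' *ᵥ Pi.single 1 1 with hu₁
    have hρD : ∀ g, ((ρ g : GL (Fin 2) ℂ) : Matrix (Fin 2) (Fin 2) ℂ) =
        Pi' * D g * ((P : GL (Fin 2) ℂ) : Matrix (Fin 2) (Fin 2) ℂ) := by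
      intro g
      have hc : (conjGL P ρ.toMonoidHom g : GL (Fin 2) ℂ) = P * ρ g * P⁻¹ := rfl
      rw [show D g = ((conjGL P ρ.toMonoidHom g : GL (Fin 2) ℂ) : Matrix (Fin 2) (Fin 2) ℂ)
          from rfl,
        hc, hPi', ← Matrix.GeneralLinearGroup.coe_mul, ← Matrix.GeneralLinearGroup.coe_mul]
      congr 1; group
    have hPP : ((P : GL (Fin 2) ℂ) : Matrix (Fin 2) (Fin 2) ℂ) * Pi' = 1 := by
      rw [hPi', ← Matrix.GeneralLinearGroup.coe_mul, mul_inv_cancel,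
        Matrix.GeneralLinearGroup.coe_one]
    have heig : ∀ g, g ∈ H →
        ((ρ g : GL (Fin 2) ℂ) : Matrix (Fin 2) (Fin 2) ℂ) *ᵥ u₀ = D g 0 0 • u₀ := by
      intro g hg
      rw [hρD, hu₀, Matrix.mulVec_mulVec, Matrix.mul_assoc, Matrix.mul_assoc, hPP,
        Matrix.mul_one, ← Matrix.mulVec_mulVec, mulVec_single_of_isDg (hDg g hg),
        Matrix.mulVec_smul]
    have hswap : ∀ g, g ∉ H →
        ((ρ g : GL (Fin 2) ℂ) : Matrix (Fin 2) (Fin 2) ℂ) *ᵥ u₀ = D g 1 0 • u₁ := by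
      intro g hg
      rw [hρD, hu₀, hu₁, Matrix.mulVec_mulVec, Matrix.mul_assoc, Matrix.mul_assoc, hPP,
        Matrix.mul_one, ← Matrix.mulVec_mulVec, mulVec_single_of_isAd (hAd g hg),
        Matrix.mulVec_smul]
    -- the intertwiner `i : ℂ → ℂ²`, `w ↦ w₀ u₀`
    let i : (Fin 1 → ℂ) →ₗ[ℂ] (Fin 2 → ℂ) := (LinearMap.proj 0).smulRight u₀
    have hi : ∀ w, i w = w 0 • u₀ := fun w => rfl
    have hφ : ∀ δ, (r.toMonoidHom) δ = r δ := fun δ => rfl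
    haveI : r.toMonoidHom.range.FiniteIndex := ⟨by rw [hrangeEq, hHi]; decide⟩
    have hi' : ∀ δ, i ∘ₗ π δ = σ (r.toMonoidHom δ) ∘ₗ i := by
      intro δ
      ext w j
      simp only [LinearMap.coe_comp, Function.comp_apply, hi, hπ, hφ, hσ, Pi.smul_apply,
        smul_eq_mul, Matrix.mulVec_smul, heig _ (hrH δ)]
      ring
    have hspan : (⨆ g : absoluteGaloisGroup K, (LinearMap.range i).map (σ g)) = ⊤ := by
      rw [eq_top_iff]
      rintro w -
      have hHtop : H ≠ ⊤ := by
        intro h; rw [h, Subgroup.index_top] at hHi; exact absurd hHi (by norm_num)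
      obtain ⟨c, hc⟩ : ∃ c, c ∉ H := by
        by_contra! hall; exact hHtop (eq_top_iff.mpr fun g _ => hall g)
      have hc10 : D c 1 0 ≠ 0 := ((hAd c hc).entry_ne_zero (hDdet c)).2
      have hu₀mem : u₀ ∈ ⨆ g : absoluteGaloisGroup K, (LinearMap.range i).map (σ g) := by
        refine Submodule.mem_iSup_of_mem 1 ⟨u₀, ⟨Pi.single 0 1, by rw [hi]; simp⟩, ?_⟩
        rw [map_one]; rfl
      have hu₁mem : u₁ ∈ ⨆ g : absoluteGaloisGroup K, (LinearMap.range i).map (σ g) := by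
        have : u₁ = (D c 1 0)⁻¹ • σ c u₀ := by
          rw [hσ, hswap c hc, smul_smul, inv_mul_cancel₀ hc10, one_smul]
        rw [this]
        refine Submodule.smul_mem _ _ (Submodule.mem_iSup_of_mem c ⟨u₀, ⟨Pi.single 0 1, ?_⟩, rfl⟩)
        rw [hi]; simp
      -- `w = (P w)₀ u₀ + (P w)₁ u₁`
      have hw : w = (((P : GL (Fin 2) ℂ) : Matrix (Fin 2) (Fin 2) ℂ) *ᵥ w) 0 • u₀ +
          (((P : GL (Fin 2) ℂ) : Matrix (Fin 2) (Fin 2) ℂ) *ᵥ w) 1 • u₁ := by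
        have h1 : w = Pi' *ᵥ (((P : GL (Fin 2) ℂ) : Matrix (Fin 2) (Fin 2) ℂ) *ᵥ w) := by
          rw [Matrix.mulVec_mulVec, hPi', ← Matrix.GeneralLinearGroup.coe_mul, inv_mul_cancel,
            Matrix.GeneralLinearGroup.coe_one, Matrix.one_mulVec]
        have h2 : ((P : GL (Fin 2) ℂ) : Matrix (Fin 2) (Fin 2) ℂ) *ᵥ w =
            (((P : GL (Fin 2) ℂ) : Matrix (Fin 2) (Fin 2) ℂ) *ᵥ w) 0 • (Pi.single 0 1 : Fin 2 → ℂ) +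
              (((P : GL (Fin 2) ℂ) : Matrix (Fin 2) (Fin 2) ℂ) *ᵥ w) 1 •
                (Pi.single 1 1 : Fin 2 → ℂ) := by
          ext j; fin_cases j <;> simp
        conv_lhs => rw [h1, h2]
        rw [Matrix.mulVec_add, Matrix.mulVec_smul, Matrix.mulVec_smul]
      rw [hw]
      exact add_mem (Submodule.smul_mem _ _ hu₀mem) (Submodule.smul_mem _ _ hu₁mem)
    have hrank : Module.finrank ℂ (Fin 2 → ℂ) =
        r.toMonoidHom.range.index * Module.finrank ℂ (Fin 1 → ℂ) := by
      rw [hrangeEq, hHi, Module.finrank_fin_fun, Module.finrank_fin_fun]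
    exact Literature.RepresentationTheory.FiniteGroups.nonempty_equiv_ind (k := ℂ) r.toMonoidHom π σ i hi' hspan hrank

end FramedArtinRep

end Literature.NumberTheory.GaloisRepresentations
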